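import Literature.IUT.LogThetaLattice.VerticallyCoricLGP
import Literature.IUT.LogThetaLattice.LocalLogShells
import HarnessLib

/-!
# [IUTchIII] Proposition 3.5 (ii) (b) "(Archimedean Primes)" at the one-factor archimedean model, over
# the genuine complex exponential — proof companion of `VerticallyCoricLGP.lean` (abc-iut cell, layer L6,
# slice [IUTchIII] §3; archimedean sibling of `VerticallyCoricLGPNonarch.lean`)

S. Mochizuki, *Inter-universal Teichmüller theory III*, kurims manuscript (May 2020), §3, Proposition 3.5
(ii) (b), p. 105, read on the page [claim: Mochizuki2012, status: disputed]: "For `v_ℚ ∈ 𝕍^arc_ℚ`, the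
closed unit ball `𝓘(^{S^±_{j+1}}𝓕(^{n,∘}𝔇_≻)_{v_ℚ})` … contains the image, via the tensor product, over
`|t| ∈ {0, …, j}`, of the [relevant] Kummer isomorphisms of (i), of both (1) the groups of units
`(Ψ_cns(^{n,m}𝔉_≻)_{|t|})^×_v` … and (2) the closed balls of radius `π` inside `(Ψ_cns(^{n,m}𝔉_≻)_{|t|})^{gp}_v`";
moreover "a closed ball as in (2) contains, for each `m' ≥ 1`, a subset that surjects, via the `m'`-th
iterate of the log-link …, onto the subset of the group of units `(Ψ_cns(^{n,m-m'}𝔉_≻)_{|t|})^×_v` on which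
this iterate is defined".

abc-iut-L6-t4's statement file types the clause as the predicate `Prop35ii_b I G U B κ lam Dom`
(`VerticallyCoricLGP.lean`); its nonarchimedean sibling (a) is DISCHARGED at the genuine `p`-adic
logarithms (`VerticallyCoricLGPNonarch.lean`, `VerticallyCoricLGPPackets.lean`), which defer "clause (b)
(archimedean, the closed ball of radius `π` in the universal covering `Ψ^∼`, Def. 1.1 (ii))". This file
DISCHARGES clause (b) at the ONE-FACTOR archimedean model of `LocalLogShells.lean` ([IUTchIII] Rmk. 1.2.2
(ii): `k = ℂ`, `𝒪_k^× = arcUnits = {|a| = 1}`, log-shell `ℐ_k = arcLogShell = {|a| ≤ π}` = the `Ψ^×`-orbit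
of the segment `[−πi, πi]`, Def. 1.1 (ii)):

* data: carriers `G m := ℂ` for every `m ∈ ℤ` (the universal covering `Ψ^∼` of `Ψ^{gp}` read in the model,
  Def. 1.1 (ii); the covering map is `Complex.exp`); unit groups `U m := arcUnits`; the closed balls of
  radius `π` `B m := arcLogShell`; Kummer maps `κ m := id` (one factor, read in the coric copy); the
  `m'`-th iterate of the log-link as the `m'`-fold covering map `lam m m' := some ∘ Complex.exp^[m']`
  (the log-link relates the carrier at `m` to the carrier at `m − 1` through the covering map, Def. 1.1
  (ii); at the model level it is everywhere defined, so `lam` is total); the portion of the units on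
  which the `m'`-th iterate of the log-link is defined `Dom _ m' := arcIterDomain m'` — the archimedean
  counterpart of abc-iut-L6-t3's `iterDomain` ([IUTchIII] Rmk. 1.1.1 (i): "iterates … are to be
  understood as being defined only on the [local] units"), computed with the PRINCIPAL branch
  `Complex.log` (the model's single-valued inverse of the covering map);
* `arcIterDomain` — `D_0 = ℂ`, `D_{k+1} = {u ∈ 𝒪^× | log u ∈ D_k}`; PROVED: `arcIterDomain_one`
  (`D_1 = 𝒪^×`), `arcIterDomain_two` (`D_2 = {e^{i}, e^{−i}}`: the units whose principal logarithm is
  again a unit), `arcIterDomain_eq_empty` (`D_{m'} = ∅` for `m' ≥ 3`: the second principal logarithm of a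
  unit is purely imaginary of norm `π/2 ≠ 1`, so a third is never defined on a unit — the archimedean
  iterates die out, in contrast to the nonarchimedean tower `iterDomain`);
* `prop35ii_b_arcExp` — **`Prop35ii_b` HOLDS for this data**: (1) `𝒪^× ⊆ ℐ` (norm `1 ≤ π`,
  `arcUnits_subset_arcLogShell`); (2) the radius-`π` balls land in `ℐ` (they are `ℐ`); and for every
  `m' ≥ 1` the radius-`π` ball contains an explicitly CHOSEN subset (`m' = 1`: the segment
  `{θi | θ ∈ (−π, π]}`, `exp_image_principalSegment`; `m' = 2`: `{±(π/2)i}`; `m' ≥ 3`: `∅`) that the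
  `m'`-fold covering map carries onto exactly `𝒪^× ∩ D_{m'}` — per the instantiation note of
  abc-iut-c312-1's `Thm311Dictionary` (referee R7-C1-N1) the witness is a chosen bounded subset, never
  the full (unbounded) preimage under the exponential.

Dictionary for the Cor. 3.12 crew: this is the archimedean half of the (Ind3) upper-bound machinery
(abc-iut-c312-1's `Column.Ind3`, archimedean clause; the `ballImage` row of `Thm311Dictionary`), as the
nonarchimedean half is `prop35ii_a_*` (consumed by `Column.ind3_non_of_prop35ii_a`). One new definition
(`arcIterDomain`); classical one-variable complex analysis only; nothing here bears on the disputed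
[IUTchIII] Cor. 3.12 or takes a side; typed ≠ discharged elsewhere.
-/

noncomputable section

namespace Literature.IUT.LogThetaLattice

open Set Complex

/-! ### Rmk 1.1.1 (i) at the archimedean model: the portion of the units on which the iterates of the
log-link are defined, computed with the principal branch -/

/-- **IUTchIII:Rmk1.1.1(i)** (kurims p. 28) at the archimedean model ([IUTchIII] Rmk. 1.2.2 (ii), `k = ℂ`):
the portion of the units `𝒪_k^× = {|a| = 1}` on which the `m'`-th iterate of the log-link is defined
("iterates … are to be understood as being defined only on the [local] units"), with the PRINCIPAL branch
`Complex.log` as the model's inverse of the covering map `exp : Ψ^∼ ↠ Ψ^{gp}` (Def. 1.1 (ii)):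
`D_0 = ℂ`, `D_{k+1} = {u ∈ 𝒪_k^× | log u ∈ D_k}` — the archimedean counterpart of `iterDomain`
(`LogLinkIterates.lean`). [claim: Mochizuki2012, status: disputed] -/
def arcIterDomain : ℕ → Set ℂ
  | 0 => univ
  | k + 1 => {z | z ∈ arcUnits ∧ Complex.log z ∈ arcIterDomain k}

/-- **IUTchIII:Rmk1.1.1(i)** (kurims p. 28) `D_0 = ℂ`. [claim: Mochizuki2012, status: disputed] -/
@[simp] theorem arcIterDomain_zero : arcIterDomain 0 = univ := rfl

/-- **IUTchIII:Rmk1.1.1(i)** (kurims p. 28) `D_{k+1} = 𝒪_k^× ∩ log⁻¹(D_k)`.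
[claim: Mochizuki2012, status: disputed] -/
theorem mem_arcIterDomain_succ (k : ℕ) (z : ℂ) :
    z ∈ arcIterDomain (k + 1) ↔ z ∈ arcUnits ∧ Complex.log z ∈ arcIterDomain k := Iff.rfl

/-- **IUTchIII:Rmk1.1.1(i)** (kurims p. 28) the first iterate is defined on all of `𝒪_k^×` (every unit
has a principal logarithm). [claim: Mochizuki2012, status: disputed] -/
theorem arcIterDomain_one : arcIterDomain 1 = arcUnits := by
  ext z
  constructor
  · rintro ⟨hz, -⟩
    exact hz
  · intro hz
    exact ⟨hz, Set.mem_univ _⟩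

/-- **IUTchIII:Rmk1.1.1(i)** (kurims p. 28) every iterate (`m' ≥ 1`) is defined only on units.
[claim: Mochizuki2012, status: disputed] -/
theorem arcIterDomain_subset_arcUnits {k : ℕ} (hk : 1 ≤ k) : arcIterDomain k ⊆ arcUnits := by
  obtain ⟨n, rfl⟩ : ∃ n, k = n + 1 := ⟨k - 1, by omega⟩
  exact fun z hz => hz.1

/-- The principal logarithm of a unit `u ∈ 𝒪_k^× = {|a| = 1}` is `arg(u)·i` (the `log`-image of the unit
circle is the segment `i·(−π, π]` of [IUTchIII] Def. 1.1 (ii)).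
[claim: Mochizuki2012, status: disputed] -/
theorem log_eq_arg_mul_I_of_mem_arcUnits {u : ℂ} (hu : u ∈ arcUnits) :
    Complex.log u = (Complex.arg u : ℂ) * I := by
  have hexp : Complex.exp ((Complex.arg u : ℂ) * I) = u := by
    have h := Complex.norm_mul_exp_arg_mul_I u
    rwa [show ‖u‖ = 1 from hu, Complex.ofReal_one, one_mul] at h
  have him : ((Complex.arg u : ℂ) * I).im = Complex.arg u := by simp
  have h1 : -Real.pi < ((Complex.arg u : ℂ) * I).im := by
    rw [him]; exact (Complex.arg_mem_Ioc u).1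
  have h2 : ((Complex.arg u : ℂ) * I).im ≤ Real.pi := by
    rw [him]; exact (Complex.arg_mem_Ioc u).2
  calc Complex.log u = Complex.log (Complex.exp ((Complex.arg u : ℂ) * I)) := by rw [hexp]
    _ = (Complex.arg u : ℂ) * I := Complex.log_exp h1 h2

/-- Hence `|log u| = |arg u|` for a unit `u`. [claim: Mochizuki2012, status: disputed] -/
theorem norm_log_of_mem_arcUnits {u : ℂ} (hu : u ∈ arcUnits) :
    ‖Complex.log u‖ = |Complex.arg u| := by
  rw [log_eq_arg_mul_I_of_mem_arcUnits hu, norm_mul, Complex.norm_I, mul_one, Complex.norm_real,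
    Real.norm_eq_abs]

/-- **IUTchIII:Rmk1.1.1(i)** (kurims p. 28) the second iterate is defined exactly on `{e^{i}, e^{−i}}`: a
unit whose principal logarithm is again a unit has `|arg| = 1`.
[claim: Mochizuki2012, status: disputed] -/
theorem arcIterDomain_two : arcIterDomain 2 = {Complex.exp I, Complex.exp (-I)} := by
  ext u
  constructor
  · rintro ⟨hu, hlog⟩
    rw [arcIterDomain_one] at hlog
    have habs : |Complex.arg u| = 1 := by
      rw [← norm_log_of_mem_arcUnits hu]; exact hlog
    have hexp : Complex.exp ((Complex.arg u : ℂ) * I) = u := by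
      have h := Complex.norm_mul_exp_arg_mul_I u
      rwa [show ‖u‖ = 1 from hu, Complex.ofReal_one, one_mul] at h
    rcases (abs_eq zero_le_one).1 habs with h | h
    · rw [h, show ((1 : ℝ) : ℂ) * I = I by norm_num] at hexp
      exact Or.inl hexp.symm
    · rw [h, show ((-1 : ℝ) : ℂ) * I = -I by push_cast; ring] at hexp
      exact Or.inr hexp.symm
  · have hIim : -Real.pi < (I : ℂ).im ∧ (I : ℂ).im ≤ Real.pi := by
      rw [Complex.I_im]; constructor <;> linarith [Real.two_le_pi]
    have hnIim : -Real.pi < (-I : ℂ).im ∧ (-I : ℂ).im ≤ Real.pi := by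
      have : (-I : ℂ).im = -1 := by simp
      rw [this]; constructor <;> linarith [Real.two_le_pi]
    rintro (rfl | rfl)
    · refine ⟨?_, ?_⟩
      · show ‖Complex.exp I‖ = 1
        rw [Complex.norm_exp, Complex.I_re, Real.exp_zero]
      · rw [Complex.log_exp hIim.1 hIim.2, arcIterDomain_one]
        exact Complex.norm_I
    · refine ⟨?_, ?_⟩
      · show ‖Complex.exp (-I)‖ = 1
        rw [Complex.norm_exp]
        simp
      · rw [Complex.log_exp hnIim.1 hnIim.2, arcIterDomain_one]
        show ‖-I‖ = 1
        rw [norm_neg]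
        exact Complex.norm_I

/-- **IUTchIII:Rmk1.1.1(i)** (kurims p. 28) the third iterate is defined NOWHERE on the units: the
principal logarithm of a unit is purely imaginary, while the candidates `e^{±i}` for its value have real
part `cos 1 > 0`. [claim: Mochizuki2012, status: disputed] -/
theorem arcIterDomain_three : arcIterDomain 3 = ∅ := by
  rw [Set.eq_empty_iff_forall_notMem]
  rintro u ⟨hu, hlog⟩
  rw [arcIterDomain_two] at hlog
  have hre : (Complex.log u).re = 0 := by
    rw [log_eq_arg_mul_I_of_mem_arcUnits hu]; simp
  have hcos : (0 : ℝ) < Real.cos 1 := Real.cos_one_pos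
  simp only [Set.mem_insert_iff, Set.mem_singleton_iff] at hlog
  rcases hlog with h | h
  · have hI : (Complex.exp I).re = Real.cos 1 := by
      rw [show (I : ℂ) = ((1 : ℝ) : ℂ) * I by norm_num, Complex.exp_ofReal_mul_I_re]
    rw [h, hI] at hre
    linarith
  · have hI : (Complex.exp (-I)).re = Real.cos 1 := by
      rw [show (-I : ℂ) = ((-1 : ℝ) : ℂ) * I by push_cast; ring, Complex.exp_ofReal_mul_I_re,
        Real.cos_neg]
    rw [h, hI] at hre
    linarith

/-- **IUTchIII:Rmk1.1.1(i)** (kurims p. 28) the archimedean iterates die out: `D_{m'} = ∅` for every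
`m' ≥ 3` (in contrast to the nonarchimedean tower `iterDomain`, nonempty at every depth).
[claim: Mochizuki2012, status: disputed] -/
theorem arcIterDomain_eq_empty : ∀ {k : ℕ}, 3 ≤ k → arcIterDomain k = ∅ := by
  intro k hk
  induction k with
  | zero => omega
  | succ n ih =>
    rcases Nat.lt_or_ge n 3 with hn | hn
    · have hn2 : n = 2 := by omega
      subst hn2
      exact arcIterDomain_three
    · rw [Set.eq_empty_iff_forall_notMem]
      rintro u ⟨-, hlog⟩
      rw [ih hn] at hlog
      exact hlog

/-! ### Prop 3.5 (ii) (b): clauses (1), (2) and the surjection witnesses -/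

/-- **IUTchIII:Prop3.5(ii)(b)** (kurims p. 105) clause (1) upstream: the units lie in the log-shell,
`𝒪_k^× ⊆ 𝒪_k ⊆ ℐ_k` (norm `1 ≤ π`; [IUTchIII] Rmk. 1.2.2 (ii) "(b^arc)").
[claim: Mochizuki2012, status: disputed] -/
theorem arcUnits_subset_arcLogShell : arcUnits ⊆ arcLogShell := fun a (ha : ‖a‖ = 1) =>
  show ‖a‖ ≤ Real.pi by rw [ha]; linarith [Real.two_le_pi]

/-- **IUTchIII:Prop3.5(ii)(b)** (kurims p. 105) the `m' = 1` witness: the covering map `exp` carries the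
segment `{θi | θ ∈ (−π, π]}` (inside the radius-`π` ball) onto the unit circle.
[claim: Mochizuki2012, status: disputed] -/
theorem exp_image_principalSegment :
    Complex.exp '' ((fun θ : ℝ => (θ : ℂ) * I) '' Set.Ioc (-Real.pi) Real.pi) = arcUnits := by
  ext u
  constructor
  · rintro ⟨-, ⟨θ, -, rfl⟩, rfl⟩
    exact Complex.norm_exp_ofReal_mul_I θ
  · intro hu
    refine ⟨(Complex.arg u : ℂ) * I, ⟨Complex.arg u, Complex.arg_mem_Ioc u, rfl⟩, ?_⟩
    have h := Complex.norm_mul_exp_arg_mul_I u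
    rwa [show ‖u‖ = 1 from hu, Complex.ofReal_one, one_mul] at h

/-- **IUTchIII:Prop3.5(ii)(b)** (kurims p. 105) **at the one-factor archimedean model over the genuine
complex exponential — `Prop35ii_b` HOLDS** for the coric log-shell `ℐ = arcLogShell = {|a| ≤ π}`
([IUTchIII] Rmk. 1.2.2 (ii)), carriers `ℂ` at every level, unit groups `arcUnits`, the closed balls of
radius `π` (`arcLogShell` itself), one-factor Kummer maps `id`, the `m'`-fold covering map
`some ∘ exp^[m']` as the `m'`-th iterate of the log-link (Def. 1.1 (ii)), and `arcIterDomain m'` as the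
portion of the units on which the iterate is defined (Rmk. 1.1.1 (i), principal branch): (1) the units
land in `ℐ`; (2) the radius-`π` balls land in `ℐ`; and for each `m' ≥ 1` the ball contains a chosen
subset (`m' = 1`: the segment `i·(−π, π]`; `m' = 2`: `{±(π/2)i}`; `m' ≥ 3`: `∅`) that the iterate
carries onto exactly the portion of the units on which it is defined.
[claim: Mochizuki2012, status: disputed] -/
theorem prop35ii_b_arcExp :
    Prop35ii_b (X := ℂ) arcLogShell (fun _ : ℤ => ℂ) (fun _ => arcUnits) (fun _ => arcLogShell)
      (fun _ => id) (fun _ (m' : ℕ) z => some (Complex.exp^[m'] z))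
      (fun _ (m' : ℕ) => arcIterDomain m') := by
  have hset : ∀ (n : ℕ) (S : Set ℂ),
      {y : ℂ | ∃ x ∈ S, some (Complex.exp^[n] x) = some y} = Complex.exp^[n] '' S := by
    intro n S
    ext y
    simp [Set.mem_image, Option.some.injEq]
  have hdom : ∀ n : ℕ, {y : ℂ | ∃ x ∈ arcIterDomain n, y = x} = arcIterDomain n := by
    intro n
    ext y
    constructor
    · rintro ⟨x, hx, rfl⟩
      exact hx
    · intro hy
      exact ⟨y, hy, rfl⟩
  refine ⟨fun m => ?_, fun m => ?_, fun m m' hm => ?_⟩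
  · show id '' arcUnits ⊆ arcLogShell
    rintro _ ⟨x, hx, rfl⟩
    exact arcUnits_subset_arcLogShell hx
  · show id '' arcLogShell ⊆ arcLogShell
    rintro _ ⟨x, hx, rfl⟩
    exact hx
  · show ∃ S ⊆ arcLogShell, {y : ℂ | ∃ x ∈ S, some (Complex.exp^[m'] x) = some y} =
      arcUnits ∩ {y : ℂ | ∃ x ∈ arcIterDomain m', y = x}
    rcases m' with _ | _ | _ | k
    · omega
    · -- `m' = 1`: the segment `i·(−π, π]`
      refine ⟨(fun θ : ℝ => (θ : ℂ) * I) '' Set.Ioc (-Real.pi) Real.pi, ?_, ?_⟩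
      · rintro _ ⟨θ, hθ, rfl⟩
        show ‖(θ : ℂ) * I‖ ≤ Real.pi
        rw [norm_mul, Complex.norm_I, mul_one, Complex.norm_real, Real.norm_eq_abs]
        exact abs_le.mpr ⟨hθ.1.le, hθ.2⟩
      · rw [hset, hdom, arcIterDomain_one, Set.inter_self, Function.iterate_one,
          exp_image_principalSegment]
    · -- `m' = 2`: the pair `{±(π/2)i}`
      refine ⟨{((Real.pi / 2 : ℝ) : ℂ) * I, -(((Real.pi / 2 : ℝ) : ℂ) * I)}, ?_, ?_⟩
      · intro z hz
        have hn : ‖((Real.pi / 2 : ℝ) : ℂ) * I‖ ≤ Real.pi := by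
          rw [norm_mul, Complex.norm_I, mul_one, Complex.norm_real, Real.norm_eq_abs,
            abs_of_nonneg (by linarith [Real.pi_pos])]
          linarith [Real.pi_pos]
        rcases hz with rfl | hz
        · exact hn
        · rw [Set.mem_singleton_iff] at hz
          subst hz
          show ‖-(((Real.pi / 2 : ℝ) : ℂ) * I)‖ ≤ Real.pi
          rw [norm_neg]
          exact hn
      · have e1 : Complex.exp (((Real.pi / 2 : ℝ) : ℂ) * I) = I := by
          rw [Complex.exp_mul_I]
          simp
        have e2 : Complex.exp (-(((Real.pi / 2 : ℝ) : ℂ) * I)) = -I := by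
          rw [show -(((Real.pi / 2 : ℝ) : ℂ) * I) = ((-(Real.pi / 2) : ℝ) : ℂ) * I by
            push_cast; ring, Complex.exp_mul_I]
          simp
        have i1 : Complex.exp^[2] (((Real.pi / 2 : ℝ) : ℂ) * I) = Complex.exp I := by
          rw [Function.iterate_succ_apply', Function.iterate_one, e1]
        have i2 : Complex.exp^[2] (-(((Real.pi / 2 : ℝ) : ℂ) * I)) = Complex.exp (-I) := by
          rw [Function.iterate_succ_apply', Function.iterate_one, e2]
        rw [hset, Set.image_pair, i1, i2, hdom,
          Set.inter_eq_self_of_subset_right (arcIterDomain_subset_arcUnits (by omega)),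
          arcIterDomain_two]
    · -- `m' ≥ 3`: the iterate is defined on no unit; the empty subset witnesses the (empty) surjection
      refine ⟨∅, Set.empty_subset _, ?_⟩
      rw [hset, Set.image_empty, hdom, arcIterDomain_eq_empty (by omega), Set.inter_empty]

end Literature.IUT.LogThetaLattice

end
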